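/-
Copyright (c) 2026 the pub-hodgecm-mathlib formalisation cell (harness21).  Prover seat hodgecm-mathlib-LH4-p13 (g8), req620 Track A «(D-RAM) FOUR-FRAME» squad
(STAGE-1b, row (2) of the piece `f_{T₊}`, the (β₂) road; LH4-p04 (g8) 16:23:48Z (AX-0) `hdich` ask: «on an axis vertex the plane value set is ONE class `e • X₊`» — the
DEEP-ORDER regime, in the line-model letters of ★ p861134 ∕ ★ p861353), 2026-09-04.
-/
import Summits.HodgeConjecture.HodgeConjecture.Theorems.F0P3cDyRamLineValueSetClassArith   -- ★ p861353 (this seat): the line-model value-set letters (`Tr_ρ(c·Θz·z)` thickened by `πinv`)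
import HarnessLib

/-!
# Crux `H413`, line LH4 «(D-RAM) FOUR-FRAME» — STAGE-1b, row (2), the (β₂) road, (S-2) part v ∕ (AX-0) feeder: «IN THE DEEP-ORDER REGIME THE LINE VALUE SET IS THE
# LEADING-NORM SET SCALED BY `Tr_ρ(c)`» — so on a deep axis vertex the plane value set is ONE class, with the explicit scalar `e = Tr_ρ(c)∕t₊`

Cell `hodgecm-mathlib` (D-0151), FLOOR 0, crux item H413 = `stmt-HodgeConjecture-24833`, route of record `HCCMUnconditional`; squad F0∕P3c∕LH4; lane
`--supports stmt-HodgeConjecture-24833 --as helper` (count-neutral; pays NO tier-0 row).  THEOREMS ONLY (no `def`, no instance, no notation, no `sorry`, default heartbeats).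
DATUM-FREE algebra over a valued field `M` with ring endomorphisms `ρ` (trace involution: isometric, fixing the thickening scalar `πinv` and the leading norms) and `Θ`.
WHY.  On the field line `B = x·𝒪_j`, `𝒪_j = jE(𝒪_K) + ϖ^j𝒪_M`, the values of `γ₂ − 1` are `Tr_ρ(c·Θz·z)` (`c = h·Θx·x·(lam − 1)`, ★ p861023 §1); for `z = jE a + ϖ^j μ` one has
`Θz·z = jE(aσa) + O(ϖ^j)`, the leading norm `n = jE(aσa)` is `ρ`-FIXED, and `Tr_ρ(c·n) = Tr_ρ(c)·n`.  This file abstracts exactly that: a set `S` of line elements, a set `N` of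
`ρ`-fixed «leading norms», and the two-sided approximation «every `c·Θz·z` is `πinv`-close to some `c·n`, and conversely» — then the thickened value set of `S` IS the thickened set
`{Tr_ρ(c)·n : n ∈ N}`, i.e. (for `N = jE(N_{K∕F}(𝒪_K))`) the class set of the explicit scalar `e = Tr_ρ(c)∕t₊` — the DEEP-ORDER case of (AX-0)'s `hdich` (`|(ϖ^{m*})⁻¹·c·ϖ^j| ≤ 1`);
the shallow orders are the (AX) face (LH4-p15), not a dichotomy.
* `trace_mul_fixed` — `Tr_ρ(c·n) = Tr_ρ(c)·n` for `ρ n = n`.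
* HEAD `setOf_thicken_traceValue_eq_leading_of_approx` — the set identity under the two approximation hypotheses.
HONEST LABEL.  Count-neutral algebra; nothing printed is asserted; no census law is stated; (β₂) stays a HYPOTHESIS; `HC_CM` is proved only modulo the 7 printed citations
(2 remaining named inputs: hLiu418 = `stmt-HodgeConjecture-24832`, h413 = `stmt-HodgeConjecture-24833`) until rung 0 closes.
## References
* [Jacobowitz1962] R. Jacobowitz, *Hermitian forms over local fields*, Amer. J. Math. 84 (1962): §4 (hermitian lines over orders of the quadratic extension).
* [Rogawski1990] J. D. Rogawski, *Automorphic Representations of Unitary Groups in Three Variables*, Ann. of Math. Stud. 123 (1990): §4.9 Prop. 4.9.1 (b) p. 55.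
-/

set_option autoImplicit false

noncomputable section
namespace Summit.HodgeConjecture.HodgeConjecture.Cruxes.H413.F0P3cDyRamLineValueSetDeepOrder

open scoped Valued WithZero

variable {M : Type*} [Field M]

/-- `Tr_ρ(c·n) = Tr_ρ(c)·n` for a `ρ`-fixed `n`. [cite: Jacobowitz1962, §4] -/
theorem trace_mul_fixed (ρ : M →+* M) (c : M) {n : M} (hn : ρ n = n) : c * n + ρ (c * n) = (c + ρ c) * n := by
  rw [map_mul, hn]; ring

variable [Valued M ℤᵐ⁰]

/-- **HEAD — THE DEEP-ORDER LINE VALUE SET IS THE LEADING-NORM SET SCALED BY `Tr_ρ(c)`.**  `ρ` isometric with `ρ πinv = πinv`; `N` a set of `ρ`-fixed elements; `S` any set with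
(i) `∀ z ∈ S, ∃ n ∈ N, |πinv·c·(Θz·z − n)| ≤ 1` and (ii) `∀ n ∈ N, ∃ z ∈ S, |πinv·c·(Θz·z − n)| ≤ 1`.  Then
`{t ∣ ∃ z ∈ S, |πinv·(t − Tr_ρ(c·Θz·z))| ≤ 1} = {t ∣ ∃ n ∈ N, |πinv·(t − Tr_ρ(c)·n)| ≤ 1}`.
(For `S = 𝒪_j`-line elements and `N = jE(N(𝒪_K))` in the regime `|(ϖ^{m*})⁻¹·c·ϖ^j| ≤ 1` both (i) and (ii) hold with `n = jE(aσa)`, `z = jE a`; the right side is the class set of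
`e = Tr_ρ(c)∕t₊`.) [cite: Jacobowitz1962, §4] [cite: Rogawski1990, §4.9 Prop. 4.9.1 (b) p. 55] -/
theorem setOf_thicken_traceValue_eq_leading_of_approx (ρ Θ : M →+* M) (hρv : ∀ x, Valued.v (ρ x) = Valued.v x) {πinv : M} (hρπ : ρ πinv = πinv) (c : M)
    {S N : Set M} (hN : ∀ n ∈ N, ρ n = n)
    (h1 : ∀ z ∈ S, ∃ n ∈ N, Valued.v (πinv * (c * (Θ z * z - n))) ≤ 1)
    (h2 : ∀ n ∈ N, ∃ z ∈ S, Valued.v (πinv * (c * (Θ z * z - n))) ≤ 1) :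
    {t : M | ∃ z ∈ S, Valued.v (πinv * (t - (c * (Θ z * z) + ρ (c * (Θ z * z))))) ≤ 1} =
      {t : M | ∃ n ∈ N, Valued.v (πinv * (t - (c + ρ c) * n)) ≤ 1} := by
  -- the error term `Tr_ρ(c·(Θz z − n))` is `πinv`-small whenever `c·(Θz z − n)` is
  have hsmall : ∀ z n : M, Valued.v (πinv * (c * (Θ z * z - n))) ≤ 1 →
      Valued.v (πinv * (c * (Θ z * z - n) + ρ (c * (Θ z * z - n)))) ≤ 1 := fun z n h => by
    rw [mul_add]
    refine (Valuation.map_add _ _ _).trans (max_le h ?_)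
    rw [show πinv * ρ (c * (Θ z * z - n)) = ρ (πinv * (c * (Θ z * z - n))) by rw [map_mul ρ πinv, hρπ], hρv]
    exact h
  -- `Tr_ρ(c Θz z) = Tr_ρ(c)·n + Tr_ρ(c(Θz z − n))` for `ρ n = n`
  have hsplit : ∀ z n : M, ρ n = n →
      c * (Θ z * z) + ρ (c * (Θ z * z)) = (c + ρ c) * n + (c * (Θ z * z - n) + ρ (c * (Θ z * z - n))) := fun z n hn => by
    simp only [map_mul, map_sub, hn]; ring
  ext t
  simp only [Set.mem_setOf_eq]
  constructor
  · rintro ⟨z, hz, ht⟩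
    obtain ⟨n, hnN, hzn⟩ := h1 z hz
    refine ⟨n, hnN, ?_⟩
    have e1 : πinv * (t - (c + ρ c) * n) = πinv * (t - (c * (Θ z * z) + ρ (c * (Θ z * z)))) + πinv * (c * (Θ z * z - n) + ρ (c * (Θ z * z - n))) := by
      rw [hsplit z n (hN n hnN)]; ring
    rw [e1]
    exact (Valuation.map_add _ _ _).trans (max_le ht (hsmall z n hzn))
  · rintro ⟨n, hnN, ht⟩
    obtain ⟨z, hz, hzn⟩ := h2 n hnN
    refine ⟨z, hz, ?_⟩
    have e1 : πinv * (t - (c * (Θ z * z) + ρ (c * (Θ z * z)))) = πinv * (t - (c + ρ c) * n) + -(πinv * (c * (Θ z * z - n) + ρ (c * (Θ z * z - n)))) := by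
      rw [hsplit z n (hN n hnN)]; ring
    rw [e1]
    exact (Valuation.map_add _ _ _).trans (max_le ht (by rw [Valuation.map_neg]; exact hsmall z n hzn))

end Summit.HodgeConjecture.HodgeConjecture.Cruxes.H413.F0P3cDyRamLineValueSetDeepOrder

end
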